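import Mathlib

/-!
# Extension of characters from an open subgroup of a topological abelian group
(kernel witness for the second half of the standard fact (A3)(b))

Blind cell `pub-hodge-repro2`, seat p4, Tier-5 support. README §8(d): this file uses an
L-value-free non-vanishing device: NO (a kernel check of a standard fact already on the cell's
record).

The standard fact (A3)(b) of `route/T5-route-2.md` §N5.11.7 (owner route-2, sub-step N5; used in
Lemma N5.L4(iv) and in Theorem N5.T3's descent) reads: «characters of a subgroup of a finite
abelian group extend to the group (restriction is surjective), and a continuous character of an
open subgroup of finite index of a locally compact abelian group extends to a continuous character
of the group (ℂ^× is divisible)». The finite half is `T5CharacterExtension.lean` (p390582). This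
file kernel-checks the second half — and shows that neither finite index nor local compactness is
needed:

* `exists_extension` — for an abelian group `G`, a subgroup `H` and a target abelian group `Q`
  that is `ℤ`-rootable (every element has `n`-th roots for every `n ≠ 0`, i.e. divisible), every
  character `χ : H →* Q` extends to `G` (Baer's criterion: a divisible abelian group is an
  injective `ℤ`-module — Mathlib's `Module.Baer.of_divisible` + `extension_property_addMonoidHom`);
* `exists_continuous_extension` — if moreover `G` is a topological group, `H` is OPEN and `χ` is
  continuous, the extension can be taken continuous (a homomorphism continuous at `1` is
  continuous, and `H` is a neighbourhood of `1`);
* the instances `RootableBy ℂˣ ℕ`, `RootableBy ℂˣ ℤ` (ℂ algebraically closed) and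
  `RootableBy Circle ℕ`, `RootableBy Circle ℤ` (unit-modulus roots), so the theorems apply to
  `ℂ^×`-valued characters (`exists_continuous_extension_units`) and to UNITARY characters
  (`exists_continuous_extension_circle`) — the latter is the form used for the characters of
  `E¹(O_v)` / `E¹_v`.

Mathlib only; no sorry; axioms ⊆ {propext, Classical.choice, Quot.sound}.
-/

namespace Summit.Ventures.HodgeRepro2.T5ContinuousCharacterExtension

open Function

/-! ### Roots in `ℂˣ` and in the circle group -/

/-- A non-zero complex number has a non-zero `n`-th root for every `n ≠ 0`. -/
theorem exists_pow_eq_units (u : ℂˣ) {n : ℕ} (hn : n ≠ 0) : ∃ r : ℂˣ, r ^ n = u := by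
  obtain ⟨z, hz⟩ := IsAlgClosed.exists_pow_nat_eq (u : ℂ) (Nat.pos_of_ne_zero hn)
  have hz0 : z ≠ 0 := by
    intro h
    rw [h, zero_pow hn] at hz
    exact u.ne_zero hz.symm
  exact ⟨Units.mk0 z hz0, Units.ext (by simp [hz])⟩

/-- `ℂˣ` is `ℕ`-rootable (every element has `n`-th roots for `n ≠ 0`). -/
noncomputable instance instRootableByUnitsNat : RootableBy ℂˣ ℕ where
  root u n := if hn : n = 0 then 1 else Classical.choose (exists_pow_eq_units u hn)
  root_zero u := by simp
  root_cancel {n} u hn := by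
    simp only [dif_neg hn]
    exact Classical.choose_spec (exists_pow_eq_units u hn)

/-- `ℂˣ` is `ℤ`-rootable (divisible). -/
noncomputable instance instRootableByUnitsInt : RootableBy ℂˣ ℤ :=
  Group.rootableByIntOfRootableByNat ℂˣ

/-- A unit-modulus complex number has a unit-modulus `n`-th root for every `n ≠ 0`. -/
theorem exists_pow_eq_circle (z : Circle) {n : ℕ} (hn : n ≠ 0) : ∃ r : Circle, r ^ n = z := by
  obtain ⟨w, hw⟩ := IsAlgClosed.exists_pow_nat_eq (z : ℂ) (Nat.pos_of_ne_zero hn)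
  have hnorm : ‖w‖ = 1 := by
    have h1 : ‖w‖ ^ n = 1 := by rw [← norm_pow, hw, Circle.norm_coe]
    exact (pow_eq_one_iff_of_nonneg (norm_nonneg w) hn).mp h1
  refine ⟨⟨w, mem_sphere_zero_iff_norm.2 hnorm⟩, Circle.ext ?_⟩
  rw [Circle.coe_pow]
  exact hw

/-- The circle group is `ℕ`-rootable. -/
noncomputable instance instRootableByCircleNat : RootableBy Circle ℕ where
  root z n := if hn : n = 0 then 1 else Classical.choose (exists_pow_eq_circle z hn)
  root_zero z := by simp
  root_cancel {n} z hn := by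
    simp only [dif_neg hn]
    exact Classical.choose_spec (exists_pow_eq_circle z hn)

/-- The circle group is `ℤ`-rootable (divisible). -/
noncomputable instance instRootableByCircleInt : RootableBy Circle ℤ :=
  Group.rootableByIntOfRootableByNat Circle

/-! ### The algebraic extension theorem (Baer) -/

section Algebraic

variable {Q : Type*} [CommGroup Q] [RootableBy Q ℤ]

/-- A `ℤ`-rootable commutative group, written additively, is `ℤ`-divisible. -/
noncomputable instance instDivisibleByAdditive : DivisibleBy (Additive Q) ℤ where
  div a n := Additive.ofMul (RootableBy.root (Additive.toMul a) n)
  div_zero a := by simp [RootableBy.root_zero]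
  div_cancel {n} a hn := by
    apply Additive.toMul.injective
    rw [toMul_zsmul, toMul_ofMul, RootableBy.root_cancel _ hn]

/-- A `ℤ`-rootable commutative group is an injective `ℤ`-module (Baer's criterion). -/
theorem baer_additive : Module.Baer ℤ (Additive Q) :=
  Module.Baer.of_divisible (Additive Q)

variable {G : Type*} [CommGroup G]

/-- THE STANDARD FACT (A3)(b), algebraic half, for any abelian group `G` and any subgroup `H`:
every character `χ : H →* Q` with values in a divisible abelian group `Q` (e.g. `ℂˣ`, the circle)
extends to a character of `G`. -/
theorem exists_extension (H : Subgroup G) (χ : H →* Q) : ∃ ψ : G →* Q, ∀ h : H, ψ h = χ h := by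
  have hinj : Injective (MonoidHom.toAdditive H.subtype) := by
    intro a b hab
    exact Additive.toMul.injective (Subtype.val_injective hab)
  obtain ⟨ψ', hψ'⟩ := (baer_additive (Q := Q)).extension_property_addMonoidHom
    (MonoidHom.toAdditive H.subtype) hinj (MonoidHom.toAdditive χ)
  refine ⟨MonoidHom.toAdditive.symm ψ', fun h => ?_⟩
  have := DFunLike.congr_fun hψ' (Additive.ofMul h)
  exact this

end Algebraic

/-! ### The continuous extension theorem -/

section Continuous

variable {G : Type*} [CommGroup G] [TopologicalSpace G] [IsTopologicalGroup G]
variable {Q : Type*} [CommGroup Q] [TopologicalSpace Q] [ContinuousMul Q]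

/-- A homomorphism `ψ : G →* Q` that is continuous on an OPEN subgroup `H` is continuous
(continuity at `1` suffices for a homomorphism of topological groups). -/
theorem continuous_of_continuousOn_open_subgroup (H : Subgroup G) (hH : IsOpen (H : Set G))
    (ψ : G →* Q) (hψ : ContinuousOn ψ (H : Set G)) : Continuous ψ :=
  continuous_of_continuousAt_one ψ (hψ.continuousAt (hH.mem_nhds H.one_mem))

variable [RootableBy Q ℤ]

/-- THE STANDARD FACT (A3)(b), continuous half: a continuous character of an OPEN subgroup `H` of a
topological abelian group `G`, with values in a divisible topological abelian group `Q`, extends to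
a continuous character of `G`. Neither finite index nor local compactness is needed. -/
theorem exists_continuous_extension (H : Subgroup G) (hH : IsOpen (H : Set G)) (χ : H →* Q)
    (hχ : Continuous χ) : ∃ ψ : G →* Q, Continuous ψ ∧ ∀ h : H, ψ h = χ h := by
  obtain ⟨ψ, hψ⟩ := exists_extension H χ
  refine ⟨ψ, continuous_of_continuousOn_open_subgroup H hH ψ ?_, hψ⟩
  rw [continuousOn_iff_continuous_restrict]
  have hrestr : (H : Set G).restrict ψ = χ := funext fun h => hψ h
  rw [hrestr]
  exact hχ

end Continuous

/-- The `ℂˣ`-valued form: a continuous character of an open subgroup extends continuously. -/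
theorem exists_continuous_extension_units {G : Type*} [CommGroup G] [TopologicalSpace G]
    [IsTopologicalGroup G] (H : Subgroup G) (hH : IsOpen (H : Set G)) (χ : H →* ℂˣ)
    (hχ : Continuous χ) : ∃ ψ : G →* ℂˣ, Continuous ψ ∧ ∀ h : H, ψ h = χ h :=
  exists_continuous_extension H hH χ hχ

/-- The UNITARY form: a continuous unitary character of an open subgroup extends to a continuous
unitary character of the group. -/
theorem exists_continuous_extension_circle {G : Type*} [CommGroup G] [TopologicalSpace G]
    [IsTopologicalGroup G] (H : Subgroup G) (hH : IsOpen (H : Set G)) (χ : H →* Circle)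
    (hχ : Continuous χ) : ∃ ψ : G →* Circle, Continuous ψ ∧ ∀ h : H, ψ h = χ h :=
  exists_continuous_extension H hH χ hχ

/-- The finite-index form of the [A]-statement is the special case (finite index is not used). -/
theorem exists_continuous_extension_of_finiteIndex {G : Type*} [CommGroup G] [TopologicalSpace G]
    [IsTopologicalGroup G] (H : Subgroup G) [H.FiniteIndex] (hH : IsOpen (H : Set G))
    (χ : H →* ℂˣ) (hχ : Continuous χ) : ∃ ψ : G →* ℂˣ, Continuous ψ ∧ ∀ h : H, ψ h = χ h :=
  exists_continuous_extension H hH χ hχ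

end Summit.Ventures.HodgeRepro2.T5ContinuousCharacterExtension
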